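import Literature.Analysis.FluidPDE.StretchingRate
import Literature.Analysis.FluidPDE.AxisymPoloidalPart
import Literature.Analysis.FluidPDE.AxisymNoSwirlScalarEq
import Literature.Analysis.FluidPDE.VorticityCalculus
import HarnessLib

/-!
# Purely azimuthal (swirl-only) fields have identically vanishing vortex stretching

Analysis/FluidPDE support file (theorems only; no new definition). For a velocity field on `ℝ³`
of the purely azimuthal form `u = g J`, `J x = (-x₁, x₀, 0)` (accepted `rotGen`), i.e.
`u = u_θ(r,z) e_θ` with `g = u_θ / r` — an axisymmetric field with zero poloidal part
(`poloidalPart u = 0`) — the vorticity `ω = curl u = (-x₀ ∂₃g, -x₁ ∂₃g, 2g + x₀∂₀g + x₁∂₁g)`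
is POLOIDAL (`⟪curl (gJ), J⟫ = 0`, accepted `inner_curl_smul_rotGen_rotGen`), while the velocity
gradient `Du(x) h = (Dg(x) h) J x + g(x) J h` maps every vector into `span{J x} + J(ℝ³)`; since
`J` is skew (`⟪J v, v⟫ = 0`), the vortex-stretching term of the enstrophy balance vanishes
pointwise:

  `⟪ω(x), Du(x) ω(x)⟫ = 0`, equivalently `α(x) = ⟪ξ, Du ξ⟫ = 0` (accepted `stretchingRate`).

In cylindrical components this is the familiar statement that for `u = u_θ(r,z) e_θ` the
rate-of-strain tensor has only `(r,θ)` and `(θ,z)` entries while `ω = (ω_r, 0, ω_z)`, so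
`ωᵀ S ω = 0` — a corollary of Majda–Bertozzi 2002, §2.3.3 eq. (2.64) (print p. 58): the
vorticity of an axisymmetric field `v = v^r e_r + v^θ e_θ + v³ e₃` is
`ω = -v^θ_{x₃} e_r + ω^θ e_θ + r⁻¹(r v^θ)_r e₃` with `ω^θ = v^r_{x₃} - v³_r`, so for `v^r = v³ = 0`
the vorticity is poloidal, and (2.68)/Prop. 2.15 (pp. 58–59): the swirl enters the vorticity
dynamics only through the source `-r⁻⁴ ∂_{x₃}(r v^θ)²` of the `ω^θ/r`-equation.

## Main statements (all proved, standard axioms)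

* `inner_curl_fderiv_curl_smul_rotGen` — `⟪curl (gJ) y, D(gJ)(y) (curl (gJ) y)⟫ = 0` at every
  point where `g` is differentiable;
* `stretchingRate_smul_rotGen` — `α(gJ)(y) = 0` there;
* `inner_curl_fderiv_curl_of_poloidalPart_eq_zero` — the same for any field with
  `poloidalPart u = 0`, at points off the axis where `u` is differentiable;
* `inner_curl_fderiv_curl_of_poloidalPart_eq_zero_of_contDiff` — for a `C¹` field with
  `poloidalPart u = 0` the stretching term vanishes at EVERY point (on the axis by continuity);
  `stretchingRate_of_poloidalPart_eq_zero_of_contDiff`, `integral_inner_curl_fderiv_curl_…`;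
* `not_exists_pos_stretching_lower_bound_of_poloidalPart_eq_zero` — consequently NO `c₀ > 0`
  with `c₀ |ω(x)|² ≤ ⟪ω(x), Du(x) ω(x)⟫` for all `x` exists as soon as `ω ≢ 0`.

Filed by the D-0090 NS-CLAIMS cell (salvage seat `ns-claims-salvage-p2`) as the TRUE negative
content behind an adjudicated display (locator, not author): `Literature.Claims.NS.SuZhen2026`
(C140), §5 p.8 l.155 «ω·∇u·ω = ω_z² ∂_z u_θ» and l.162 «ω·∇u·ω ≥ c₀|ω|², c₀ > 263.34» for the
purely azimuthal datum `u = (0, u_θ(r,z), 0)` of l.151 — for every such field the left-hand side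
is identically `0`.

## References

* A. J. Majda, A. L. Bertozzi, *Vorticity and Incompressible Flow*, CUP 2002, §2.3.3
  «Axisymmetric Flows with a General Swirl», eqs. (2.63)–(2.64), (2.68), Prop. 2.15 (print
  pp. 58–59, held text `book:majda2002-vorticity-incompressible-flow` p0058–p0059); §5.1 eq. (5.9)
  for `α = (𝒟ξ)·ξ`. [`MajdaBertozziCUP2002`]

WHAT THIS IS NOT: not a claim about NS regularity or blow-up; not a claim about any author beyond
the typed locator.
-/

noncomputable section

open Set Function Filter MeasureTheory InnerProductSpace
open scoped RealInnerProductSpace Topology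

namespace Literature.Analysis.FluidPDE

variable {g : EuclideanSpace ℝ (Fin 3) → ℝ} {u : EuclideanSpace ℝ (Fin 3) → EuclideanSpace ℝ (Fin 3)} {y : EuclideanSpace ℝ (Fin 3)}

/-! ### The explicit azimuthal form `u = g J` -/

/-- **Swirl-only fields have zero vortex stretching (explicit form).** For `u = g J` and every
point `y` where `g` is differentiable, `⟪ω(y), Du(y) ω(y)⟫ = 0` with `ω = curl u`: indeed
`Du(y) ω = (Dg ω) J y + g J ω`, and `⟪ω, J y⟫ = 0` (the vorticity of `gJ` is poloidal) while
`⟪ω, J ω⟫ = 0` (`J` is skew). [cite: MajdaBertozziCUP2002, §2.3.3 eqs. (2.63)–(2.64)] -/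
theorem inner_curl_fderiv_curl_smul_rotGen (hg : DifferentiableAt ℝ g y) :
    ⟪curl (fun x => g x • rotGen x) y,
      fderiv ℝ (fun x => g x • rotGen x) y (curl (fun x => g x • rotGen x) y)⟫ = 0 := by
  rw [fderiv_smul_rotGen_apply hg, inner_add_right, inner_smul_right, inner_smul_right,
    inner_curl_smul_rotGen_rotGen hg, real_inner_comm, inner_rotGen_self]
  ring

/-- **Swirl-only fields have zero stretching rate (explicit form)**: `α(gJ)(y) = 0` wherever `g`
is differentiable (`α = ⟪ξ, Du ξ⟫`, accepted `stretchingRate`).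
[cite: MajdaBertozziCUP2002, §2.3.3 eqs. (2.63)–(2.64) with §5.1 eq. (5.9)] -/
theorem stretchingRate_smul_rotGen (hg : DifferentiableAt ℝ g y) :
    stretchingRate (fun x => g x • rotGen x) y = 0 := by
  rw [stretchingRate_eq_inv_mul_inner, inner_curl_fderiv_curl_smul_rotGen hg, mul_zero]

/-! ### Coordinate-free form: fields with zero poloidal part -/

/-- A field with vanishing poloidal part IS `g J` with `g = Γ/ϱ²` (`Γ` the swirl).
[folklore] -/
private theorem eq_smul_rotGen_of_poloidalPart_eq_zero (hpol : ∀ x, poloidalPart u x = 0) :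
    u = fun x => (swirl u x / cylRadius x ^ 2) • rotGen x := by
  funext x
  have h := hpol x
  rw [poloidalPart_eq_sub_smul_rotGen, sub_eq_zero] at h
  exact h

/-- **Zero poloidal part ⇒ zero vortex stretching, off the axis.** If `poloidalPart u = 0`
(purely azimuthal field) and `u` is differentiable at a point `y` off the axis, then
`⟪ω(y), Du(y) ω(y)⟫ = 0`. [cite: MajdaBertozziCUP2002, §2.3.3 eqs. (2.63)–(2.64)] -/
theorem inner_curl_fderiv_curl_of_poloidalPart_eq_zero (hpol : ∀ x, poloidalPart u x = 0)
    (hd : DifferentiableAt ℝ u y) (hy : cylRadius y ≠ 0) :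
    ⟪curl u y, fderiv ℝ u y (curl u y)⟫ = 0 := by
  have hg : DifferentiableAt ℝ (fun x => swirl u x / cylRadius x ^ 2) y :=
    differentiableAt_swirl_div_sq hd hy
  rw [eq_smul_rotGen_of_poloidalPart_eq_zero hpol]
  exact inner_curl_fderiv_curl_smul_rotGen hg

/-- Off the axis, `α(y) = 0` for a purely azimuthal field differentiable at `y`.
[cite: MajdaBertozziCUP2002, §2.3.3 eqs. (2.63)–(2.64) with §5.1 eq. (5.9)] -/
theorem stretchingRate_of_poloidalPart_eq_zero (hpol : ∀ x, poloidalPart u x = 0)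
    (hd : DifferentiableAt ℝ u y) (hy : cylRadius y ≠ 0) : stretchingRate u y = 0 := by
  rw [stretchingRate_eq_inv_mul_inner, inner_curl_fderiv_curl_of_poloidalPart_eq_zero hpol hd hy,
    mul_zero]

/-- The stretching term `x ↦ ⟪ω(x), Du(x) ω(x)⟫` of a `C¹` field is continuous. [folklore] -/
private theorem continuous_inner_curl_fderiv_curl (hu : ContDiff ℝ 1 u) :
    Continuous fun x => ⟪curl u x, fderiv ℝ u x (curl u x)⟫ := by
  have hc : Continuous (curl u) := continuous_curl hu
  have hD : Continuous fun x => fderiv ℝ u x := hu.continuous_fderiv one_ne_zero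
  exact hc.inner (hD.clm_apply hc)

/-- **Zero poloidal part ⇒ zero vortex stretching everywhere (C¹ fields).** For a `C¹` purely
azimuthal field the stretching term vanishes at every point of `EuclideanSpace ℝ (Fin 3)` — off the axis by
`inner_curl_fderiv_curl_of_poloidalPart_eq_zero`, on the axis by continuity along
`y + t e₀`, `t → 0`. [cite: MajdaBertozziCUP2002, §2.3.3 eqs. (2.63)–(2.64)] -/
theorem inner_curl_fderiv_curl_of_poloidalPart_eq_zero_of_contDiff (hu : ContDiff ℝ 1 u)
    (hpol : ∀ x, poloidalPart u x = 0) (y : EuclideanSpace ℝ (Fin 3)) :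
    ⟪curl u y, fderiv ℝ u y (curl u y)⟫ = 0 := by
  set F : EuclideanSpace ℝ (Fin 3) → ℝ := fun x => ⟪curl u x, fderiv ℝ u x (curl u x)⟫ with hF
  have hFc : Continuous F := continuous_inner_curl_fderiv_curl hu
  -- off the axis the claim is the previous lemma
  have hoff : ∀ x : EuclideanSpace ℝ (Fin 3), cylRadius x ≠ 0 → F x = 0 := fun x hx =>
    inner_curl_fderiv_curl_of_poloidalPart_eq_zero hpol (hu.differentiable one_ne_zero x) hx
  by_cases hy : cylRadius y ≠ 0
  · exact hoff y hy
  push Not at hy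
  -- on the axis: approach along `y + t • e₀`, `t ≠ 0`
  set γ : ℝ → EuclideanSpace ℝ (Fin 3) := fun t => y + t • EuclideanSpace.single 0 1 with hγ
  have hγc : Continuous γ := by fun_prop
  have hγ0 : γ 0 = y := by simp [hγ]
  have hoffγ : ∀ t : ℝ, t ≠ 0 → F (γ t) = 0 := by
    intro t ht
    apply hoff
    intro h0
    have h00 : (γ t) 0 = 0 := ((cylRadius_eq_zero_iff _).1 h0).1
    have hy0 : y 0 = 0 := ((cylRadius_eq_zero_iff _).1 hy).1
    simp [hγ, hy0] at h00
    exact ht h00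
  have h1 : Tendsto (fun t => F (γ t)) (𝓝[≠] (0 : ℝ)) (𝓝 (F y)) := by
    have := ((hFc.comp hγc).tendsto 0).mono_left (nhdsWithin_le_nhds (s := {(0 : ℝ)}ᶜ))
    simpa [Function.comp_def, hγ0] using this
  have h2 : Tendsto (fun t => F (γ t)) (𝓝[≠] (0 : ℝ)) (𝓝 0) := by
    refine (tendsto_const_nhds (x := (0 : ℝ))).congr' ?_
    filter_upwards [self_mem_nhdsWithin] with t ht
    exact (hoffγ t ht).symm
  exact tendsto_nhds_unique h1 h2

/-- `α ≡ 0` for a `C¹` purely azimuthal field.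
[cite: MajdaBertozziCUP2002, §2.3.3 eqs. (2.63)–(2.64) with §5.1 eq. (5.9)] -/
theorem stretchingRate_of_poloidalPart_eq_zero_of_contDiff (hu : ContDiff ℝ 1 u)
    (hpol : ∀ x, poloidalPart u x = 0) (y : EuclideanSpace ℝ (Fin 3)) : stretchingRate u y = 0 := by
  rw [stretchingRate_eq_inv_mul_inner,
    inner_curl_fderiv_curl_of_poloidalPart_eq_zero_of_contDiff hu hpol y, mul_zero]

/-- The enstrophy-balance stretching integral `∫ ⟪ω, Du ω⟫` of a `C¹` purely azimuthal field is
`0`. [cite: MajdaBertozziCUP2002, §2.3.3 eqs. (2.63)–(2.64)] -/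
theorem integral_inner_curl_fderiv_curl_of_poloidalPart_eq_zero (hu : ContDiff ℝ 1 u)
    (hpol : ∀ x, poloidalPart u x = 0) :
    ∫ x, ⟪curl u x, fderiv ℝ u x (curl u x)⟫ = 0 := by
  simp [inner_curl_fderiv_curl_of_poloidalPart_eq_zero_of_contDiff hu hpol]

/-- **No positive pointwise lower bound for the stretching of a swirl-only field.** If `u` is
`C¹` with `poloidalPart u = 0` and its vorticity does not vanish identically, there is NO
constant `c₀ > 0` with `c₀ |ω(x)|² ≤ ⟪ω(x), Du(x) ω(x)⟫` for all `x` (the right-hand side is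
identically `0`). [cite: MajdaBertozziCUP2002, §2.3.3 eqs. (2.63)–(2.64)] -/
theorem not_exists_pos_stretching_lower_bound_of_poloidalPart_eq_zero (hu : ContDiff ℝ 1 u)
    (hpol : ∀ x, poloidalPart u x = 0) (hω : ∃ x, curl u x ≠ 0) :
    ¬ ∃ c₀ : ℝ, 0 < c₀ ∧ ∀ x, c₀ * ‖curl u x‖ ^ 2 ≤ ⟪curl u x, fderiv ℝ u x (curl u x)⟫ := by
  rintro ⟨c₀, hc₀, h⟩
  obtain ⟨x, hx⟩ := hω
  have h1 := h x
  rw [inner_curl_fderiv_curl_of_poloidalPart_eq_zero_of_contDiff hu hpol x] at h1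
  have h2 : 0 < c₀ * ‖curl u x‖ ^ 2 := mul_pos hc₀ (pow_pos (norm_pos_iff.2 hx) 2)
  linarith

/-- Explicit-form companion: for `u = g J` with `g ∈ C¹` and `curl u ≢ 0` there is no `c₀ > 0`
with `c₀ |ω|² ≤ ⟪ω, Du ω⟫` everywhere. [cite: MajdaBertozziCUP2002, §2.3.3 eqs. (2.63)–(2.64)] -/
theorem not_exists_pos_stretching_lower_bound_smul_rotGen (hg : Differentiable ℝ g)
    (hω : ∃ x, curl (fun x => g x • rotGen x) x ≠ 0) :
    ¬ ∃ c₀ : ℝ, 0 < c₀ ∧ ∀ x, c₀ * ‖curl (fun x => g x • rotGen x) x‖ ^ 2 ≤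
      ⟪curl (fun x => g x • rotGen x) x,
        fderiv ℝ (fun x => g x • rotGen x) x (curl (fun x => g x • rotGen x) x)⟫ := by
  rintro ⟨c₀, hc₀, h⟩
  obtain ⟨x, hx⟩ := hω
  have h1 := h x
  rw [inner_curl_fderiv_curl_smul_rotGen (hg x)] at h1
  have h2 : 0 < c₀ * ‖curl (fun x => g x • rotGen x) x‖ ^ 2 :=
    mul_pos hc₀ (pow_pos (norm_pos_iff.2 hx) 2)
  linarith

end Literature.Analysis.FluidPDE
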